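import Summits.AtomisticToContinuum.BoseEinsteinCondensation.Theorems.BECHardSphereReductionHardSphereBECDensityMonotoneReductions
import Summits.AtomisticToContinuum.BoseEinsteinCondensation.Theorems.BECHardSphereReductionZeroModeGlue
import Summits.AtomisticToContinuum.BoseEinsteinCondensation.Theorems.BECHardSphereReductionHardSphereScaling
import HarnessLib

/-!
# Crux `HardSphereBEC` (stmt-AtomisticToContinuum-11885), line `registered` — the stub
# `stub_densityMonotone` is the low-density ZERO-ONE LAW for hard-sphere BEC

Route `BECHardSphereReduction`, skeleton `Cruxes/HardSphereBEC/Lines/birth.lean` (sha c763a27be332),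
companion of `BECHardSphereReductionHardSphereBECDensityMonotoneReductions` (which derives the
stub from `HardSphereBoxMonotone`, stmt-11886, and from the crux).  Here we pin down EXACTLY what
the registered stub

  `∃ η₀ > 0, ∀ η η', 0 < η' → η' ≤ η → η ≤ η₀ → HasGroundStateBEC HS₁ η → HasGroundStateBEC HS₁ η'`

says, by excluded middle on "is there a BEC density below `η₀`?":

* `densityMonotone_iff_hardSphereBEC_or_eventually_not` — the stub signature (verbatim) is
  EQUIVALENT to the dichotomy
  `HardSphereBEC ∨ ∃ η₀ > 0, ∀ η ∈ (0, η₀], ¬ HasGroundStateBEC HS₁ η`: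
  near zero reduced density the unit hard-sphere gas condenses either at EVERY density or at NONE.
  (`→`: if some `η₁ ≤ η₀` condenses, monotone propagation fills `(0, η₁]` and the proved scale
  covariance `HardSphereScaling` (11887) transports unit-diameter BEC at `ρ a³` to diameter-`a` BEC
  at `ρ`, `hardSphereBEC_of_unit_interval`; otherwise no `η ≤ η₀` condenses.  `←`: the crux gives
  the stub outright, `densityMonotone_of_hardSphereBEC`; if nothing below `η₀` condenses the stub
  is vacuous.)
* `hardSphereBEC_or_eventually_not_of_hardSphereBoxMonotone` — hence box monotonicity (11886)
  already implies this zero-one law.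

Consequence for the line (recorded 2026-08-17): an UNCONDITIONAL proof of `stub_densityMonotone`
is an unconditional proof of the zero-one law.  Neither disjunct is decidable today (the first is
LSSY's open problem in the model case, the second is physically false and unprovable), so such a
proof must establish the disjunction without deciding it — i.e. a genuine downward PROPAGATION of
condensation in the density, which is the open monotonicity content isolated in
`densityMonotone_of_eventually_condensateNumber_le` and supplied by stmt-11886.
-/

noncomputable section

namespace Summit.AtomisticToContinuum.BoseEinsteinCondensation.Cruxes.HardSphereBEC

open MeasureTheory ENNReal Filter Literature.MathematicalPhysics.QuantumManyBody.BoseGas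
open Summit.AtomisticToContinuum.BoseEinsteinCondensation.Theses.BECHardSphereReduction
open Summit.AtomisticToContinuum.BoseEinsteinCondensation.Theorems

/-- **Unit-diameter BEC on an initial interval of reduced densities is the crux.**  If
`HasGroundStateBEC HS₁ η` for all `η ∈ (0, η₁]`, then for every diameter `a > 0` and
`0 < ρ < η₁ / a³` one has `HasGroundStateBEC HS_a ρ`: by the proved scale covariance
`condensateNumber HS_a N L = condensateNumber HS₁ N (L/a)` (`hardSphereScaling_proof`, stmt-11887)
and `L_N(ρ)/a = L_N(ρ a³)` (`sideLength_mul_pow_three`).  (The conclusion is the BODY of the crux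
decl `HardSphereBEC`, verbatim, rather than the constant: a by-name conclusion under hypotheses
would be an uncredited conditional proof of the item.) [folklore] -/
theorem hardSphereBEC_of_unit_interval {η₁ : ℝ} (hη₁ : 0 < η₁)
    (h : ∀ η : ℝ, 0 < η → η ≤ η₁ →
      HasGroundStateBEC (Set.indicator (Set.Iic 1) (fun _ : ℝ => (⊤ : ENNReal))) η) :
    ∀ a : ℝ, 0 < a → ∃ ρ₀ : ℝ, 0 < ρ₀ ∧ ∀ ρ : ℝ, 0 < ρ → ρ < ρ₀ →
      Literature.MathematicalPhysics.QuantumManyBody.BoseGas.HasGroundStateBEC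
        (Set.indicator (Set.Iic a) (fun _ : ℝ => (⊤ : ENNReal))) ρ := by
  intro a ha
  have ha3 : 0 < a ^ 3 := pow_pos ha 3
  refine ⟨η₁ / a ^ 3, div_pos hη₁ ha3, fun ρ hρ hρlt => ?_⟩
  have hη : 0 < ρ * a ^ 3 := mul_pos hρ ha3
  have hηle : ρ * a ^ 3 ≤ η₁ := ((lt_div_iff₀ ha3).1 hρlt).le
  obtain ⟨c, hc, hev⟩ := h (ρ * a ^ 3) hη hηle
  refine ⟨c, hc, ?_⟩
  filter_upwards [hev] with N hN
  rw [hardSphereScaling_proof a (sideLength ρ N) N ha, ← sideLength_mul_pow_three hρ ha N]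
  exact hN

/-- **The stub `stub_densityMonotone` is the low-density zero-one law for unit hard-sphere BEC**:
its signature (verbatim) is equivalent to
`HardSphereBEC ∨ ∃ η₀ > 0, ∀ η ∈ (0, η₀], ¬ HasGroundStateBEC HS₁ η`.
`→`: by cases on whether some `η₁ ∈ (0, η₀]` condenses — if so, propagation fills `(0, η₁]` and
`hardSphereBEC_of_unit_interval` gives the crux; if not, that is the second disjunct.
`←`: `densityMonotone_of_hardSphereBEC`, resp. vacuity. [folklore] -/
theorem densityMonotone_iff_hardSphereBEC_or_eventually_not :
    (∃ η₀ : ℝ, 0 < η₀ ∧ ∀ η η' : ℝ, 0 < η' → η' ≤ η → η ≤ η₀ →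
      Literature.MathematicalPhysics.QuantumManyBody.BoseGas.HasGroundStateBEC
        (Set.indicator (Set.Iic 1) (fun _ : ℝ => (⊤ : ENNReal))) η →
      Literature.MathematicalPhysics.QuantumManyBody.BoseGas.HasGroundStateBEC
        (Set.indicator (Set.Iic 1) (fun _ : ℝ => (⊤ : ENNReal))) η') ↔
    (HardSphereBEC ∨ ∃ η₀ : ℝ, 0 < η₀ ∧ ∀ η : ℝ, 0 < η → η ≤ η₀ →
      ¬ HasGroundStateBEC (Set.indicator (Set.Iic 1) (fun _ : ℝ => (⊤ : ENNReal))) η) := by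
  constructor
  · rintro ⟨η₀, hη₀, hmono⟩
    by_cases hex : ∃ η₁ : ℝ, 0 < η₁ ∧ η₁ ≤ η₀ ∧
        HasGroundStateBEC (Set.indicator (Set.Iic 1) (fun _ : ℝ => (⊤ : ENNReal))) η₁
    · obtain ⟨η₁, hη₁, hle, hB⟩ := hex
      exact Or.inl (hardSphereBEC_of_unit_interval hη₁
        fun η hη hηle => hmono η₁ η hη hηle hle hB)
    · push Not at hex
      exact Or.inr ⟨η₀, hη₀, fun η hη hle hB => hex η hη hle hB⟩
  · rintro (h | ⟨η₀, hη₀, hno⟩)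
    · exact densityMonotone_of_hardSphereBEC h
    · exact ⟨η₀, hη₀, fun η η' hη' hle hη₀le hB =>
        absurd hB (hno η (hη'.trans_le hle) hη₀le)⟩

/-- **Box monotonicity implies the zero-one law**: from `HardSphereBoxMonotone` (stmt-11886),
near zero reduced density the unit hard-sphere gas has ground-state BEC either at every density
(and then the crux `HardSphereBEC` holds) or at none. [folklore] -/
theorem hardSphereBEC_or_eventually_not_of_hardSphereBoxMonotone (h : HardSphereBoxMonotone) :
    HardSphereBEC ∨ ∃ η₀ : ℝ, 0 < η₀ ∧ ∀ η : ℝ, 0 < η → η ≤ η₀ →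
      ¬ HasGroundStateBEC (Set.indicator (Set.Iic 1) (fun _ : ℝ => (⊤ : ENNReal))) η :=
  densityMonotone_iff_hardSphereBEC_or_eventually_not.1 (densityMonotone_of_hardSphereBoxMonotone h)

end Summit.AtomisticToContinuum.BoseEinsteinCondensation.Cruxes.HardSphereBEC

end
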